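import Literature.NumberTheory.EllipticCurves.ModularParametrizationTrustBaseProofs
import Literature.NumberTheory.EllipticCurves.ModularParametrizationDegreeHoldsProofs
import Literature.NumberTheory.EllipticCurves.HeegnerPointsModularityProofs
import Literature.NumberTheory.EllipticCurves.AnalyticRankModularityProofs
import Literature.NumberTheory.EllipticCurves.BSDRootNumberModularityOnlyProofs
import Literature.NumberTheory.EllipticCurves.LeadingTerm
import Literature.NumberTheory.EllipticCurves.BSDQuadraticDescent
import Literature.NumberTheory.EllipticCurves.GrossZagierRationalPoint
import Literature.NumberTheory.EllipticCurves.NonvanishingTwistsPrescribedSplitting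
import Literature.NumberTheory.EllipticCurves.NonvanishingTwistsBumpFriedbergHoffstein
import HarnessLib

set_option linter.dupNamespace false -- `…BirchSwinnertonDyer.BirchSwinnertonDyer…` is the cell's nested layout (D-0017)
set_option autoImplicit false

/-!
# Modularity collapse of the displayed published inputs (LADDER-BSD D-0154 (2), INPUTS-LIST-1 row 2 p1):
# items 19273, 25143, 20428 — and the packs 20389 / 25112 — from ONE modularity input (19266 or 19382)

Seat `bsd-inputs-r2-p1` (gen 0), `--supports` stmt-BirchSwinnertonDyer-20428 (also serves 25143, 19266, 19273).
THEOREMS ONLY (no definition, no named fact, no `sorry`); ROUTE-FREE: this module imports `Literature.*` only, so a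
route file (`Theses/*.lean`) — and hence an in-route `closes` theorem such as `ThetaPartnerAtTwo.closes` /
`ResidualThetaTransportAtTwo.closes` — may import it without an import cycle, as may any `Theorems` file.

## What this file records

The W-ALL rows 1–2 routes (`UniversalToricDescent`, `SemiOrdinaryEisensteinDescent`, `CumulativeHeegnerLeopoldt`,
`RamifiedHeegnerPair`, `ThetaPartnerAtTwo`, `ResidualThetaTransportAtTwo`, `BiquadraticEisensteinDescent`, and some
forty other routes sharing the same by-name items) DISPLAY up to five modularity-type published inputs:

* item 19266 `ModularParametrizationSupply := nonempty_modularParametrizationData` (BCDT 2001 Thm. A, form (6));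
* item 19382 `NewformOfEllipticCurve := exists_isNewformOf` (Modularity Theorem, Version L; Diamond–Shurman Thm. 8.8.3);
* item 19273 `EntireLFunctionRat := WeierstrassCurve.hasEntireLFunction_rat` (entire continuation of `L(E, s)`);
* item 25143 `PublishedInputParity := ∀ W, even_analyticRank_iff_rootNumber_eq_one W` (Silverman AEC C.16 Thm. 16.3, p. 451);
* conjuncts 3–4 of item 20428 `ToricParametrisedInputs` (parity again, and `∀ W K, exists_isHeegnerPoint W K`, the
  `K`-rationality of Heegner points, Gross–Zagier 1986 I.§4 / Darmon 2004 §3.7).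

Every one of them follows from EITHER of the two modularity currencies 19266 / 19382 by theorems ALREADY LANDED
(nothing is re-derived and no landed declaration is restated here; each proof term composes the cited tree theorems):

| conclusion (item signature VERBATIM) | from 19266 `nonempty_modularParametrizationData` | from 19382 `exists_isNewformOf` |
|---|---|---|
| the other currency | LANDED: `ModularForms.exists_isNewformOf_of_nonempty_modularParametrizationData` (`ModularParametrizationBCDTProofs`) | LANDED: the term `ModularForms.nonempty_modularParametrizationData_of_exists_isNewformOf hnf ModularForms.IsNewformOf.exists_maninConstant_ne_zero_holds` (`…TrustBaseProofs` + `…DegreeHoldsProofs`; named `Theorems.maninLocalTwoThree_nonempty_modularParametrizationData_of_exists_isNewformOf`, and `.mpr` of `ModularForms.nonempty_modularParametrizationData_iff_exists_isNewformOf_unconditional` in `Literature/NumberTheory/Automorphic/ShimuraCurveRibetTakahashiOptimalProofs`) |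
| 19273 `hasEntireLFunction_rat` | `entireLFunctionRat_of_modularParametrization` (§1) | LANDED: `WeierstrassCurve.hasEntireLFunction_rat_of_exists_isNewformOf` (`AnalyticRankModularityProofs`) |
| 25143 parity family | `publishedInputParity_of_modularParametrization` (§1) | `publishedInputParity_of_newform` (§2; per curve LANDED: `even_analyticRank_iff_rootNumber_eq_one_of_exists_isNewformOf`, `BSDRootNumberModularityOnlyProofs` — Hecke + Atkin–Lehner are tree theorems) |
| `∀ W K, exists_isHeegnerPoint W K` | `heegnerPoints_of_modularParametrization` (§1; per `(W, K)` LANDED: `exists_isHeegnerPoint_of_nonempty_modularParametrizationData`, `HeegnerPointsModularityProofs`) | LANDED: `Theorems.GoldfeldGoodTwists.exists_isHeegnerPoint_of_exists_isNewformOf` (route-bound module `GoldfeldK12AdditiveTwoSevensHalves`) = `heegnerPoints_of_modularParametrization` ∘ the 19382 → 19266 term |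
| 20428 `ToricParametrisedInputs` modulo its two research conjuncts (GZ, Kolyvagin) | `toricParametrisedInputs_of_gz_koly_modularParametrization` (§1) | `toricParametrisedInputs_of_gz_koly_newform` (§2) |
| 20389 pack `ToricPublishedInputs` = `PublishedInputsWildThree` from 7 of its 10 conjuncts | `toricPublishedInputs_of_modularParametrization` (§3) | `toricPublishedInputs_of_newform` (§3) |
| 25112 pack `PublishedInputTwists` from 3 of its 4 children | — | `publishedInputTwists_of_newform` (§3) |
| 19266 ↔ 19382 | LANDED: `ModularForms.nonempty_modularParametrizationData_iff_exists_isNewformOf_unconditional` | |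

Every conclusion is typed as the ITEM SIGNATURE verbatim (a closed `Prop` over `Literature` names); every route decl of
these items (`Theses.<Route>.ModularParametrizationSupply`, `….EntireLFunctionRat`, `….NewformOfEllipticCurve`,
`….PublishedInputParity`, `….ToricParametrisedInputs`, `….ToricPublishedInputs`, `….PublishedInputsWildThree`,
`….PublishedInputTwists`) is a `def … : Prop :=` alias of that signature, so the theorems apply to the route decls by
definitional unfolding (`exact`), in hypotheses and conclusions alike (checked for UTD, SOED, CHL, RHP, TPT, RTT, BED).

## Use (for the route pens; W-71: edit / `--resplit`, never open)

* UTD / SOED / CHL (pack 20389, split into 7 children + glue 20429 / 20497 / 24222): the pack follows from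
  `RankEqAnalyticRankLeOne`, `ModularParametrizationSupply`, `BSDQuotientIsogenyInvariance`, `GrossZagierRationalPointI73`,
  `FriedbergHoffsteinHeegnerSplitDivisorsTwist` and the two research families `∀ N W K, gross_zagier N W K`,
  `∀ N W K, kolyvagin N W K` — `toricPublishedInputs_of_modularParametrization`, binders in the glue's order with
  `EntireLFunctionRat` dropped and `ToricParametrisedInputs` replaced by its conjuncts 1–2; displayed modularity-type
  inputs 4 → 1 (19266), or 19382 via `toricPublishedInputs_of_newform`.
* RHP (pack 25112): `publishedInputTwists_of_newform : BFH → FH → NewformOfEllipticCurve → PublishedInputTwists`, i.e. the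
  child 25143 is redundant next to 19382.
* TPT / RTT (`closes (hmod : ModularParametrizationSupply) (hLrat : EntireLFunctionRat) …`): `have hLrat :=
  entireLFunctionRat_of_modularParametrization hmod` after importing THIS module into the route file (no cycle).

## Honest framing

CONDITIONAL results: each theorem turns a displayed input into a consequence of another displayed input; no item is
closed by this file (a by-name alias item closes only on its own signature, and 19266 / 19382 are the Modularity Theorem —
Wiles 1995, Taylor–Wiles 1995, Breuil–Conrad–Diamond–Taylor 2001 — not formalised in the tree); Gross–Zagier and
Kolyvagin stay binders. Proving / typing an input makes a conditional line unconditional only AS TYPED. BSD is not proved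
by any of this.

References: [BCDTJAMS2001] Thm. A and p. 845 (1)–(6), "(2) ⇒ (6)"; [DiamondShurman2005] Thm. 5.10.2, Thm. 8.8.3;
[SilvermanAEC2009] C.16 Thm. 16.3 and remark p. 451; [AtkinLehner1970] Thm. 3; [GrossZagier1986] I.§4, I.(6.3), I.(7.3);
[Darmon2004] Thms. 3.6–3.7, §3.7; [Gross1991] Thm. 1.3; [Kolyvagin1990] Thm. A.
-/

namespace Summit.BirchSwinnertonDyer.BirchSwinnertonDyer.Theorems.PublishedInputsOfNewform

open Literature.NumberTheory.EllipticCurves Literature.NumberTheory.EllipticCurves.ModularForms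

/-! ## §1 From the parametrisation-datum currency (item 19266 `ModularParametrizationSupply`, BCDT Thm. A form (6)) -/

/-- **19266 ⟹ 19273** (signature of item 19273 `EntireLFunctionRat` verbatim): the entire continuation of `L(E, s)` for
every elliptic `W/ℚ` (`WeierstrassCurve.hasEntireLFunction_rat`) from the parametrisation datum — (6) ⇒ (2)
(`exists_isNewformOf_of_nonempty_modularParametrizationData`: the datum carries its newform, the global minimal model by
`hasGlobalMinimalModel_rat_holds`), then Hecke's analytic continuation of `L(f, s)` for the attached weight-`2` cusp form
(`WeierstrassCurve.hasEntireLFunction_rat_of_exists_isNewformOf`, Diamond–Shurman Thm. 5.10.2 with Thm. 8.8.3).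
Conditional; closes nothing. [cite: DiamondShurman2005, Thm. 8.8.3 with Thm. 5.10.2]
[cite: BCDTJAMS2001, Thm. A with p. 845, "(6) ⇒ (2)"] -/
theorem entireLFunctionRat_of_modularParametrization (hmod : nonempty_modularParametrizationData) :
    WeierstrassCurve.hasEntireLFunction_rat :=
  WeierstrassCurve.hasEntireLFunction_rat_of_exists_isNewformOf
    (exists_isNewformOf_of_nonempty_modularParametrizationData hmod)

/-- **19266 ⟹ 25143** (signature of item 25143 `PublishedInputParity` verbatim): for every `W/ℚ`,
`ord_{s=1} L(E, s)` is even iff `w(E) = 1` (Silverman AEC C.16, Thm. 16.3 and remark, p. 451), from the parametrisation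
datum — via (6) ⇒ (2) and `even_analyticRank_iff_rootNumber_eq_one_of_exists_isNewformOf` (modularity alone: Hecke's
functional equation with sign for newforms, `IsNewform0.exists_functional_equation_holds`, and the Taylor-expansion
parity argument are tree theorems). Conditional; closes nothing.
[cite: SilvermanAEC2009, C.16 Thm. 16.3 and remark, p. 451] [cite: BCDTJAMS2001, Thm. A] -/
theorem publishedInputParity_of_modularParametrization (hmod : nonempty_modularParametrizationData) :
    ∀ W : WeierstrassCurve ℚ, even_analyticRank_iff_rootNumber_eq_one W :=
  fun W => even_analyticRank_iff_rootNumber_eq_one_of_exists_isNewformOf W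
    (exists_isNewformOf_of_nonempty_modularParametrizationData hmod)

/-- **19266 ⟹ Heegner points are `K`-rational** (conjunct 4 of item 20428 / conjunct 10 of item 20389, verbatim): for
every `W/ℚ` and number field `K`, `exists_isHeegnerPoint W K` (for globally minimal elliptic `W` and an imaginary
quadratic `K` with the Heegner hypothesis for `N_E`, some `P ∈ E(K)` is a Heegner point; Gross–Zagier 1986 I.§4,
Darmon 2004 Thms. 3.6–3.7 and §3.7), from the parametrisation datum alone — the tree theorem
`exists_isHeegnerPoint_of_nonempty_modularParametrizationData` (CM theory over the field of singular moduli and the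
`Aut(ℂ)`-equivariance of every datum are proved there), quantified over `(W, K)`. Conditional; closes nothing.
[cite: GrossZagier1986, I.§4] [cite: Darmon2004, Thm. 3.6, Thm. 3.7 and §3.7] -/
theorem heegnerPoints_of_modularParametrization (hmod : nonempty_modularParametrizationData) :
    ∀ (W : WeierstrassCurve ℚ) (K : Type) [Field K] [NumberField K], exists_isHeegnerPoint W K :=
  fun W K _ _ => exists_isHeegnerPoint_of_nonempty_modularParametrizationData W K hmod

/-- **Item 20428 `ToricParametrisedInputs` (signature verbatim) from its two research conjuncts and 19266**: the
parametrised published inputs (Gross–Zagier ∧ Kolyvagin ∧ parity ∧ Heegner points over `K`) of the toric kernel follow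
from the Gross–Zagier family (`hGZ`; GZ 1986 I.(6.3), Cai–Shu–Tian 2014 Thm. 1.1), the Kolyvagin family (`hKo`;
Kolyvagin 1990 Thm. A, Gross 1991 Thm. 1.3) and the parametrisation datum (`hmod`, BCDT Thm. A (6)), conjuncts 3–4 being
`publishedInputParity_of_modularParametrization` and `heegnerPoints_of_modularParametrization`. Conditional; closes
nothing (GZ and Kolyvagin are not formalised). [cite: GrossZagier1986, I.(6.3) and I.§4] [cite: Gross1991, Thm. 1.3]
[cite: SilvermanAEC2009, C.16 Thm. 16.3 and remark, p. 451] -/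
theorem toricParametrisedInputs_of_gz_koly_modularParametrization
    (hGZ : ∀ (N : ℕ) [NeZero N] (W : WeierstrassCurve ℚ) (K : Type) [Field K] [NumberField K], gross_zagier N W K)
    (hKo : ∀ (N : ℕ) [NeZero N] (W : WeierstrassCurve ℚ) (K : Type) [Field K] [NumberField K], kolyvagin N W K)
    (hmod : nonempty_modularParametrizationData) :
    (∀ (N : ℕ) [NeZero N] (W : WeierstrassCurve ℚ) (K : Type) [Field K] [NumberField K], gross_zagier N W K) ∧
    (∀ (N : ℕ) [NeZero N] (W : WeierstrassCurve ℚ) (K : Type) [Field K] [NumberField K], kolyvagin N W K) ∧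
    (∀ (W : WeierstrassCurve ℚ), even_analyticRank_iff_rootNumber_eq_one W) ∧
    (∀ (W : WeierstrassCurve ℚ) (K : Type) [Field K] [NumberField K], exists_isHeegnerPoint W K) :=
  ⟨hGZ, hKo, publishedInputParity_of_modularParametrization hmod, heegnerPoints_of_modularParametrization hmod⟩

/-! ## §2 From the newform currency (item 19382 `NewformOfEllipticCurve`, Modularity Theorem Version L)

19382 ⟹ 19266 is, in the tree, the term `nonempty_modularParametrizationData_of_exists_isNewformOf hnf
IsNewformOf.exists_maninConstant_ne_zero_holds` ("(2) ⇒ (6) by a construction of Shimura and a theorem of Faltings",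
BCDT p. 845: Eichler–Shimura congruence by Honda's method + Faltings' isogeny theorem, both PROVED in `Literature/`); it is
used inline below (a by-name copy is landed as `Theorems.maninLocalTwoThree_nonempty_modularParametrizationData_of_exists_isNewformOf`
and as `.mpr` of `nonempty_modularParametrizationData_iff_exists_isNewformOf_unconditional`; not restated here).
19382 ⟹ 19273 is the landed `WeierstrassCurve.hasEntireLFunction_rat_of_exists_isNewformOf` itself. -/

/-- **19382 ⟹ 25143** (signature of item 25143 `PublishedInputParity` verbatim): parity of the analytic rank vs the
root number for every `W/ℚ`, from the Modularity Theorem alone — the tree theorem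
`even_analyticRank_iff_rootNumber_eq_one_of_exists_isNewformOf` (`BSDRootNumberModularityOnlyProofs`), quantified over
`W`. This is the «provable-now from NewformOfEllipticCurve» reduction recorded in item 25143's docstring. Conditional;
closes nothing. [cite: SilvermanAEC2009, C.16 Thm. 16.3 and remark, p. 451] [cite: BCDTJAMS2001, Thm. A]
[cite: AtkinLehner1970, Thm. 3] -/
theorem publishedInputParity_of_newform (hnf : exists_isNewformOf) :
    ∀ W : WeierstrassCurve ℚ, even_analyticRank_iff_rootNumber_eq_one W :=
  fun W => even_analyticRank_iff_rootNumber_eq_one_of_exists_isNewformOf W hnf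

/-- **Item 20428 `ToricParametrisedInputs` (signature verbatim) from its two research conjuncts and 19382**: the
Gross–Zagier family (`hGZ`), the Kolyvagin family (`hKo`) and the Modularity Theorem (`hnf`) give the four parametrised
published inputs of the toric kernel — the theorem named in INPUTS-LIST-1 §3′(1); the step 19382 ⟹ 19266 is the
Manin-constant term of the §2 header. Conditional; closes nothing (GZ and Kolyvagin are not formalised; modularity is a
named input). [cite: GrossZagier1986, I.(6.3) and I.§4] [cite: Gross1991, Thm. 1.3] [cite: Kolyvagin1990, Thm. A]
[cite: BCDTJAMS2001, Thm. A with p. 845, "(2) ⇒ (6)"] [cite: SilvermanAEC2009, C.16 Thm. 16.3 and remark, p. 451] -/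
theorem toricParametrisedInputs_of_gz_koly_newform
    (hGZ : ∀ (N : ℕ) [NeZero N] (W : WeierstrassCurve ℚ) (K : Type) [Field K] [NumberField K], gross_zagier N W K)
    (hKo : ∀ (N : ℕ) [NeZero N] (W : WeierstrassCurve ℚ) (K : Type) [Field K] [NumberField K], kolyvagin N W K)
    (hnf : exists_isNewformOf) :
    (∀ (N : ℕ) [NeZero N] (W : WeierstrassCurve ℚ) (K : Type) [Field K] [NumberField K], gross_zagier N W K) ∧
    (∀ (N : ℕ) [NeZero N] (W : WeierstrassCurve ℚ) (K : Type) [Field K] [NumberField K], kolyvagin N W K) ∧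
    (∀ (W : WeierstrassCurve ℚ), even_analyticRank_iff_rootNumber_eq_one W) ∧
    (∀ (W : WeierstrassCurve ℚ) (K : Type) [Field K] [NumberField K], exists_isHeegnerPoint W K) :=
  toricParametrisedInputs_of_gz_koly_modularParametrization hGZ hKo
    (nonempty_modularParametrizationData_of_exists_isNewformOf hnf IsNewformOf.exists_maninConstant_ne_zero_holds)

/-! ## §3 Slim forms of the displayed packs 20389 (UTD / SOED / CHL) and 25112 (RHP) -/

/-- **Pack 20389 (`ToricPublishedInputs` of `UniversalToricDescent` / `CumulativeHeegnerLeopoldt`, `PublishedInputsWildThree`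
of `SemiOrdinaryEisensteinDescent`; signature verbatim) from SEVEN of its ten conjuncts**, in the order of the landed glue
20429 / 20497 / 24222 with `EntireLFunctionRat` (19273) dropped and `ToricParametrisedInputs` (20428) replaced by its two
research conjuncts: Gross–Zagier–Kolyvagin rank theorem (`hGZK`, 19921), the parametrisation datum (`hmod`, 19266),
BSD-quotient isogeny invariance (`hIso`, 19307), Gross–Zagier I.(7.3) (`hI73`, 19369), Friedberg–Hoffstein Thm. B with
prescribed splitting (`hFH`, 19449), the Gross–Zagier family (`hGZ`) and the Kolyvagin family (`hKo`). Conjuncts 4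
(entire `L`), 9 (parity) and 10 (Heegner points) are supplied by §1 from `hmod`. A candidate statement for the pens'
`--resplit` of 20389 (7 children instead of 8; displayed modularity-type inputs 4 → 1). Conditional; closes nothing.
[cite: BCDTJAMS2001, Thm. A] [cite: GrossZagier1986, I.(6.3), I.(7.3) and I.§4] [cite: Gross1991, Thm. 1.3]
[cite: SilvermanAEC2009, C.16 Thm. 16.3 and remark, p. 451] -/
theorem toricPublishedInputs_of_modularParametrization
    (hGZK : rank_eq_analyticRank_of_analyticRank_le_one) (hmod : nonempty_modularParametrizationData)
    (hIso : WeierstrassCurve.bsdRHS_eq_of_isIsogenous) (hI73 : GrossZagier1986_thm_I_7_3)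
    (hFH : friedbergHoffstein_exists_heegnerField_splitDivisors_twist_ne_zero)
    (hGZ : ∀ (N : ℕ) [NeZero N] (W : WeierstrassCurve ℚ) (K : Type) [Field K] [NumberField K], gross_zagier N W K)
    (hKo : ∀ (N : ℕ) [NeZero N] (W : WeierstrassCurve ℚ) (K : Type) [Field K] [NumberField K], kolyvagin N W K) :
    (∀ (N : ℕ) [NeZero N] (W : WeierstrassCurve ℚ) (K : Type) [Field K] [NumberField K], gross_zagier N W K) ∧
    (∀ (N : ℕ) [NeZero N] (W : WeierstrassCurve ℚ) (K : Type) [Field K] [NumberField K], kolyvagin N W K) ∧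
    rank_eq_analyticRank_of_analyticRank_le_one ∧ WeierstrassCurve.hasEntireLFunction_rat ∧
    nonempty_modularParametrizationData ∧ WeierstrassCurve.bsdRHS_eq_of_isIsogenous ∧ GrossZagier1986_thm_I_7_3 ∧
    friedbergHoffstein_exists_heegnerField_splitDivisors_twist_ne_zero ∧
    (∀ (W : WeierstrassCurve ℚ), even_analyticRank_iff_rootNumber_eq_one W) ∧
    (∀ (W : WeierstrassCurve ℚ) (K : Type) [Field K] [NumberField K], exists_isHeegnerPoint W K) :=
  ⟨hGZ, hKo, hGZK, entireLFunctionRat_of_modularParametrization hmod, hmod, hIso, hI73, hFH,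
    publishedInputParity_of_modularParametrization hmod, heegnerPoints_of_modularParametrization hmod⟩

/-- **Pack 20389 (signature verbatim) from seven inputs, modularity in NEWFORM currency** (`hnf`, item 19382) — the
variant of `toricPublishedInputs_of_modularParametrization` for a display that keeps 19382 rather than 19266 (conjunct 5,
the parametrisation datum, is then the Manin-constant term of the §2 header). Conditional; closes nothing.
[cite: BCDTJAMS2001, Thm. A with p. 845, "(2) ⇒ (6)"] [cite: GrossZagier1986, I.(6.3), I.(7.3) and I.§4]
[cite: Gross1991, Thm. 1.3] -/
theorem toricPublishedInputs_of_newform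
    (hGZK : rank_eq_analyticRank_of_analyticRank_le_one) (hnf : exists_isNewformOf)
    (hIso : WeierstrassCurve.bsdRHS_eq_of_isIsogenous) (hI73 : GrossZagier1986_thm_I_7_3)
    (hFH : friedbergHoffstein_exists_heegnerField_splitDivisors_twist_ne_zero)
    (hGZ : ∀ (N : ℕ) [NeZero N] (W : WeierstrassCurve ℚ) (K : Type) [Field K] [NumberField K], gross_zagier N W K)
    (hKo : ∀ (N : ℕ) [NeZero N] (W : WeierstrassCurve ℚ) (K : Type) [Field K] [NumberField K], kolyvagin N W K) :
    (∀ (N : ℕ) [NeZero N] (W : WeierstrassCurve ℚ) (K : Type) [Field K] [NumberField K], gross_zagier N W K) ∧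
    (∀ (N : ℕ) [NeZero N] (W : WeierstrassCurve ℚ) (K : Type) [Field K] [NumberField K], kolyvagin N W K) ∧
    rank_eq_analyticRank_of_analyticRank_le_one ∧ WeierstrassCurve.hasEntireLFunction_rat ∧
    nonempty_modularParametrizationData ∧ WeierstrassCurve.bsdRHS_eq_of_isIsogenous ∧ GrossZagier1986_thm_I_7_3 ∧
    friedbergHoffstein_exists_heegnerField_splitDivisors_twist_ne_zero ∧
    (∀ (W : WeierstrassCurve ℚ), even_analyticRank_iff_rootNumber_eq_one W) ∧
    (∀ (W : WeierstrassCurve ℚ) (K : Type) [Field K] [NumberField K], exists_isHeegnerPoint W K) :=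
  toricPublishedInputs_of_modularParametrization hGZK
    (nonempty_modularParametrizationData_of_exists_isNewformOf hnf IsNewformOf.exists_maninConstant_ne_zero_holds)
    hIso hI73 hFH hGZ hKo

/-- **Pack 25112 (`PublishedInputTwists` of `RamifiedHeegnerPair`; signature verbatim) from THREE of its four children**:
Bump–Friedberg–Hoffstein 1990 (i) (`hBFH`, 25006), Friedberg–Hoffstein 1995 Thm. B(1) with prescribed splitting (`hFH`,
19449) and the Modularity Theorem (`hnf`, 19382); the fourth child, parity (25143), is `publishedInputParity_of_newform hnf`.
Binders in the order of glue 25144 with `PublishedInputParity` dropped — a candidate statement for the pen's `--resplit`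
of 25112. Conditional; closes nothing. [cite: SilvermanAEC2009, C.16 Thm. 16.3 and remark, p. 451]
[cite: BCDTJAMS2001, Thm. A] -/
theorem publishedInputTwists_of_newform
    (hBFH : bumpFriedbergHoffstein_exists_heegnerField_split_twist_simpleZero)
    (hFH : friedbergHoffstein_exists_heegnerField_splitDivisors_twist_ne_zero) (hnf : exists_isNewformOf) :
    bumpFriedbergHoffstein_exists_heegnerField_split_twist_simpleZero ∧
    friedbergHoffstein_exists_heegnerField_splitDivisors_twist_ne_zero ∧ exists_isNewformOf ∧
    (∀ W : WeierstrassCurve ℚ, even_analyticRank_iff_rootNumber_eq_one W) :=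
  ⟨hBFH, hFH, hnf, publishedInputParity_of_newform hnf⟩

end Summit.BirchSwinnertonDyer.BirchSwinnertonDyer.Theorems.PublishedInputsOfNewform
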